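import Summits.HodgeConjecture.HodgeConjecture.Theorems.Ring2AbelianAllAndreHalfInverseRestriction
import Summits.HodgeConjecture.HodgeConjecture.Theorems.Ring2AbelianAllAndreNondegenerateInverse
import Summits.HodgeConjecture.HodgeConjecture.Theorems.Ring2AbelianAllAndreTransposedInverses
import Summits.HodgeConjecture.HodgeConjecture.Theorems.Ring2AbelianAllAndreCorrespondenceCategory
import Summits.HodgeConjecture.HodgeConjecture.Theorems.Ring2AbelianAllAndreProductPencils
import Summits.HodgeConjecture.HodgeConjecture.Theorems.Ring2AbelianAllAndreWeilLineTransport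
import HarnessLib

/-!
# Ring 2 · sub-cell AbelianAll (ALL ABELIAN VARIETIES), André axis, part U-a — AUXILIARY CARRIERS OF THE MIDDLE INVARIANTS:
# β in the middle degree `d` from ONE algebraic correspondence `D : H^m(B) → H^d(𝒳)` out of an auxiliary smooth projective `B`
# (`dim B = m`) mapping `H^m(B)` ONTO the invariants `j_t^* H^d(𝒳)` of one member with `b_m(B) ≤ dim j_t^* H^d(𝒳)`; the member trace
# of a correspondence `B ⊢ 𝒳` is its restricted class on `X_s × B` (to be spread over the padded pencil `𝒳 × B → S` of seat b02's
# `Ring2BindersAbelianSchemeVHCMiddleLift`); flatness of eigenclass data of any character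

HONEST FRAMING (page 1, verbatim): **research route, not a corollary; conditional on HC_CM plus one named
minimal statement.** Cell line: research route conditional on HC_CM; not a corollary; Q11.4-sentence-2
already refuted in dim ≥ 3. Nothing in this file proves a case of the Hodge conjecture or of `B(X)` for a named `X`; `HC_CM`
(`Theses.RankFourFaces.CMAbelianHodge`), `HC_AV`, the global nodes and every named fact are ABSENT (fact-free bookkeeping on the carriers).
Item `Theses.RankFourFaces.CMToAbelian` (stmt-16267) stays OPEN; N104 untouched; no node is born (0 `def`, 0 `sorry`). Seat
`pub-hodge-ring2-ab-andre-2`, gen 51 (part U: the ODD Weil cell `d = 3` through the CM elliptic curve; this file is its fact-free engine).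
Bears on rung H1d (home `stmt-HodgeConjecture-17489`; the `d = 3` rung «B for compact abelian-threefold pencils») as the engine of part U-b.

## Content (theorems only; standard axioms)

Parts XL–XLVI reduced `B⋆` of the total space of a compact abelian pencil `f : 𝒳 ⟶ S` to β at one point and shaped the β-witness as a
lift / half inverse THROUGH A MEMBER `X_t` (the product pencil `𝒳 × X_t → S`). THIS FILE replaces the member by an ARBITRARY auxiliary
smooth projective variety `B`:

* §1 **`exists_map_fiberι_corrAction_eq_smul_whiskerRight`** — for any smooth projective `B` and any class `μ` on `𝒳 × B`, the member trace
  `j_s^* ∘ [μ]_* : H^•(B) → H^•(X_s)` of the correspondence `[μ]_* : H^•(B) → H^•(𝒳)` is `K · [(j_s × 1_B)^* μ]_*` with ONE scalar `K ≠ 0`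
  (clean base change, Fulton Thm. 6.2 (a); part XLVI-c proved the case `B = X_t`).
* §2 **`map_chart_fiberι_mem_pullbackEigenclasses_member_of_member`** — on a compact abelian pencil with one global endomorphism `Φ` over `S`
  and `Φ`-compatible charts `(A_s, e_s, φ_s)`, a global class whose charted restriction at ONE member is a `χ`-eigenclass of `(A_t, φ_t)` is a
  `χ`-eigenclass of `(A_s, φ_s)` at EVERY member, for every degree and every character (part L-e exported the `E_±` cases only).
* §3 **`exists_betaInverse_middle_of_auxiliary`** — THE ENGINE: for a compact pencil of abelian `d`-folds, a point `t`, a smooth projective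
  `B` of dimension `m` and an ALGEBRAIC correspondence `D : H^m(B) → H^d(𝒳)` such that (i) `j_t^* ∘ D` maps `H^m(B)` ONTO the invariants
  `j_t^* H^d(𝒳)` and (ii) `b_m(B) ≤ dim j_t^* H^d(𝒳)`: **β holds at `t` in the middle degree `d`** — witness `T = D ∘ Dᵗ` made exact by
  part XLI-a (`Dᵗ` the Poincaré transpose of part XLVI-a; the fibre trace `j_t^* D Dᵗ j_{t*}` is injective on the invariants because
  `Dᵗ j_{t*}` is injective there (Deligne's `Im j_t^* ⊥ ker j_{t*}` + (i) + Poincaré duality on `X_t`), hence ONTO `H^m(B)` by (ii), and then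
  `D u`, `u = Dᵗ j_{t*} x`, dies on `X_t` only if `u ⊥ H^m(B)`, i.e. `u = 0`, i.e. `x = 0`).

## Honest status

Fact-free; the hypotheses (i)–(ii) say that the middle invariants of one member are CARRIED by the middle cohomology of `B` through an
algebraic class on `𝒳 × B`. For `B = E` a CM elliptic curve and `d = 3` part U-b discharges them from Markman's FOURFOLD theorem on the
elliptic completions `X_s × E` (the odd Weil cell of rung H1d′). Nothing minimal is claimed; N104 untouched. EDGE LABELS: all K (no binder).
References: Fulton1998 (Prop. 1.7, Thm. 6.2 (a), §16.1); Kleiman1968AlgebraicCycles (§1.3, App. to §2 2A11); DeligneHodgeII1971 (4.1.1 (iii));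
VoisinHodgeII2003 (proof of Thm. 10.17 (10.7)); Deligne1982HodgeCycles (§4, proof of Thm. 4.8); HatcherAT2002 (§3.3 Prop. 3.38).
-/

noncomputable section

set_option linter.dupNamespace false

namespace Summit.HodgeConjecture.HodgeConjecture.Ring2.AbelianAll

open CategoryTheory CategoryTheory.Limits AlgebraicGeometry MonoidalCategory CartesianMonoidalCategory
open Literature.AlgebraicGeometry Literature.AlgebraicGeometry.Motives
open Literature.AlgebraicGeometry.HodgeTheory
open Literature.AlgebraicTopology.SingularHomology (singularCohomology cupProduct cupProduct_map cupPairing cupPairing_apply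
  cupProduct_gradedComm_holds)
open Summit.HodgeConjecture.HodgeConjecture.Theorems (deg_fiberGysin_aux)

/-! ## §0 Graded symmetry of the Poincaré pairing of any oriented smooth projective variety -/

/-- `⟨x, y⟩ = (−1)^{pq} ⟨y, x⟩` for the cup-product pairing of a smooth projective variety (complex orientation). [cite: HatcherAT2002, §3.2 Thm. 3.11] -/
theorem cupPairing_comm_smoothProjective {n : ℕ} {X : SchemeOver ℂ} (hX : IsSmoothProjective n X) {p q : ℕ} (h : p + q = 2 * n)
    (h' : q + p = 2 * n) (x : complexBetti X p) (y : complexBetti X q) :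
    cupPairing (complexOrientationFamily hX) h x y = (-1 : ℂ) ^ (p * q) * cupPairing (complexOrientationFamily hX) h' y x := by
  rw [cupPairing_apply, cupPairing_apply, cupProduct_gradedComm_holds ℂ _ h h', map_smul, LinearMap.smul_apply, smul_eq_mul]

section Pencil

variable {𝒳 S : SchemeOver ℂ} {d : ℕ} {f : 𝒳 ⟶ S} (hf : IsCompactAbelianPencil f d)

/-- `𝐣[s, k]` — `j_s^* : Hᵏ(𝒳(ℂ); ℂ) → Hᵏ(X_s(ℂ); ℂ)` as a linear map (display notation). [cite: VoisinHodgeI2002, §7.3.2] -/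
local notation3 (prettyPrint := false) "𝐣[" s ", " k "]" => (complexBetti.map (fiberι f s) k).hom

/-! ## §1 The member trace of a correspondence `B ⊢ 𝒳` is its restricted class on `X_s × B` -/

section Restriction

/-- **ONE CLEAN BASE CHANGE, ARBITRARY SOURCE: `j_s^* ∘ [μ]_* = K · [(j_s × 1_B)^* μ]_*`.** Let `f : 𝒳 ⟶ S` be a compact pencil of abelian
`d`-folds, `B` smooth projective of dimension `m`, `s ∈ S(ℂ)`. There is ONE scalar `K ≠ 0` such that for every class `μ ∈ H^{2e}((𝒳 × B)(ℂ); ℂ)`,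
every degree (`k + 2e = b + 2m`) and every `x ∈ Hᵏ(B)`: `j_s^*([μ]_* x) = K • [(j_s ▷ B)^* μ]_* x` in `Hᵇ(X_s)` — the trace on the member `X_s` of
the correspondence `[μ]_* : H^•(B) → H^•(𝒳)` is the action of the restriction of `μ` to `X_s × B`. Clean base change (Fulton Thm. 6.2 (a), the
tree's `complexGysin_cleanBaseChange`) for the transversal square `X_s × B → 𝒳 × B` over `j_s` (first projections), then
`(j_s ▷ B)^*(pr_2^* x ∪ μ) = pr_2^* x ∪ (j_s ▷ B)^* μ`; part XLVI-c's `exists_map_fiberι_corrAction_eq_smul_restrict` is the case `B = X_t`.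
[cite: Fulton1998, Prop. 1.7, Thm. 6.2 (a) and §16.1] [cite: FultonYoungTableaux1997, Appendix B §B.1 (5)–(7)] -/
theorem exists_map_fiberι_corrAction_eq_smul_whiskerRight {m : ℕ} {B : SchemeOver ℂ} (hB : IsSmoothProjective m B)
    (s : ComplexPoints S) :
    ∃ K : ℂ, K ≠ 0 ∧ ∀ ⦃k e b : ℕ⦄ (hab : k + 2 * e = b + 2 * m) (μ : complexBetti (𝒳 ⊗ B) (2 * e)) (x : complexBetti B k),
      𝐣[s, b] (corrAction complexOrientationFamily hf.isSmoothProjective_total hB hab μ x) =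
        K • corrAction complexOrientationFamily (hf.isSmoothProjective_fiberOver s) hB hab
          (complexBetti.map (fiberι f s ▷ B) (2 * e) μ) x := by
  have hX := hf.isSmoothProjective_total
  have hXs := hf.isSmoothProjective_fiberOver s
  have hXB := IsSmoothProjective.tensor_holds hX hB
  have hXsB := IsSmoothProjective.tensor_holds hXs hB
  set j : fiberOver f s ⟶ 𝒳 := fiberι f s with hj
  haveI : IsSeparated S.hom := hf.isSmoothProjective_base.isProjectiveOver.isProper.toIsSeparated
  haveI : IsClosedImmersion j.left := Motives.isClosedImmersion_fiberι_left f s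
  haveI : IsSeparated ((𝒳 ⊗ B) ⊗ fiberOver f s).hom :=
    (IsSmoothProjective.isProper_holds (IsSmoothProjective.tensor_holds hXB hXs)).toIsSeparated
  -- the square `X_s × B → 𝒳 × B` over `j : X_s → 𝒳` (first projections)
  haveI hA : IsClosedImmersion (lift (j ▷ B) (fst (fiberOver f s) B)).left := by
    refine isClosedImmersion_left_of_retraction _ (lift (snd (𝒳 ⊗ B) (fiberOver f s)) (fst _ _ ≫ snd 𝒳 B)) ?_
    ext
    · simp only [Category.assoc, lift_fst, lift_snd, Category.id_comp]
    · simp only [Category.assoc, lift_snd, lift_fst_assoc, whiskerRight_snd, Category.id_comp]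
  have hinc : ∀ (P : ComplexPoints (𝒳 ⊗ B)) (Q : ComplexPoints (fiberOver f s)),
      AlgPoints.map (fst 𝒳 B) P = AlgPoints.map j Q →
      ∃ R : ComplexPoints (fiberOver f s ⊗ B), AlgPoints.map (j ▷ B) R = P ∧
        AlgPoints.map (fst (fiberOver f s) B) R = Q := by
    intro P Q h
    set R : ComplexPoints (fiberOver f s ⊗ B) := AlgPoints.prodEquiv.symm (Q, AlgPoints.map (snd 𝒳 B) P) with hR
    have hR1 : AlgPoints.map (fst (fiberOver f s) B) R = Q := by
      rw [← AlgPoints.prodEquiv_apply_fst, hR, Equiv.apply_symm_apply]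
    have hR2 : AlgPoints.map (snd (fiberOver f s) B) R = AlgPoints.map (snd 𝒳 B) P := by
      rw [← AlgPoints.prodEquiv_apply_snd, hR, Equiv.apply_symm_apply]
    refine ⟨R, AlgPoints.prodEquiv.injective (Prod.ext ?_ ?_), hR1⟩
    · rw [AlgPoints.prodEquiv_apply_fst, AlgPoints.prodEquiv_apply_fst, ← AlgPoints.map_comp_apply, whiskerRight_fst,
        AlgPoints.map_comp_apply, hR1, h]
    · rw [AlgPoints.prodEquiv_apply_snd, AlgPoints.prodEquiv_apply_snd, ← AlgPoints.map_comp_apply, whiskerRight_snd, hR2]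
  obtain ⟨K, hK⟩ := complexGysin_cleanBaseChange complexOrientationFamily hXB hX hXs hXsB (fst 𝒳 B) j
    (j ▷ B) (fst (fiberOver f s) B) (by omega) hinc
  refine ⟨K, ?_, fun k e b hab μ x ↦ ?_⟩
  · -- `K ≠ 0`: test on a fibre integral `pr_{1*} pr_2^* w ≠ 0` in `H⁰(𝒳)`, whose pull-back to `X_s` is non-zero
    obtain ⟨w, hw⟩ := exists_complexGysin_fst_map_snd_ne_zero complexOrientationFamily hX hB
    obtain ⟨c, hc⟩ := exists_eq_smul_one complexOrientationFamily hX
      (complexGysin complexOrientationFamily hXB hX (fst 𝒳 B) (show 2 * m + 2 * (d + 1) = 0 + 2 * (d + 1 + m) by omega)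
        (complexBetti.map (snd 𝒳 B) (2 * m) w))
    have hc0 : c ≠ 0 := by
      rintro rfl
      exact hw (by rw [hc, zero_smul])
    have h1 : singularCohomology.one ℂ (ComplexPoints (fiberOver f s)) ≠ 0 := by
      intro h0
      apply fiberGysin_one_ne_zero hf s
      rw [h0, map_zero]
    intro hK0
    have h := hK (show 2 * m + 2 * (d + 1) = 0 + 2 * (d + 1 + m) by omega) (complexBetti.map (snd 𝒳 B) (2 * m) w)
    rw [hK0, zero_smul, hc, map_smul] at h
    change c • singularCohomology.map ℂ ℂ (AlgPoints.mapContinuous (L := ℂ) j) 0 (singularCohomology.one ℂ _) = 0 at h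
    rw [singularCohomology.map_one] at h
    exact (smul_ne_zero hc0 h1) h
  · -- the identity
    rw [corrAction_apply, corrAction_apply, hK (corrAction_degree (d + 1) hab), cupProduct_map]
    -- `(j ▷ B)^* pr_2^* = pr_2^*`
    have e1 : complexBetti.map (j ▷ B) k (complexBetti.map (snd 𝒳 B) k x) = complexBetti.map (snd (fiberOver f s) B) k x := by
      rw [← CategoryTheory.comp_apply, ← complexBetti.map_comp, whiskerRight_snd]
    rw [e1]

end Restriction

end Pencil

/-! ## §2 Eigenclass data of any character are flat along a compact abelian pencil with a global endomorphism -/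

section EigenTransport

variable {𝒳 S : SchemeOver ℂ} {f : 𝒳 ⟶ S} {d : ℕ}

/-- **A `χ`-EIGENCLASS AT ONE MEMBER IS A `χ`-EIGENCLASS AT EVERY MEMBER.** On a compact abelian pencil with a global endomorphism `Φ` over `S`
and `Φ`-compatible charts `(A_s, e_s, φ_s)`, a global class `U ∈ Hᵏ(𝒳(ℂ); ℂ)` with `e_t^*(U|X_t) ∈ pullbackEigenclasses (A t) (φ t) k χ` at ONE member
has `e_s^*(U|X_s) ∈ pullbackEigenclasses (A s) (φ s) k χ` at EVERY member (Ehresmann on complex points, path-connectedness of `S(ℂ)`, part L-e's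
`mem_pullbackEigenclasses_of_transport`; part L-e exported the two Weil-line cases). [cite: Deligne1982HodgeCycles, §4 proof of Thm. 4.8 (pp. 56–61)]
[cite: VoisinHodgeI2002, Thm. 9.3 and §9.2.1] -/
theorem map_chart_fiberι_mem_pullbackEigenclasses_member_of_member (hf : IsCompactAbelianPencil f d)
    (Φ : 𝒳 ⟶ 𝒳) (hΦ : Φ ≫ f = f)
    (A : ComplexPoints S → AbelianVariety ℂ) (e : ∀ s, (A s).X ≅ fiberOver f s) (φ : ∀ s, A s ⟶ A s)
    (hK : ∀ s, ∃ Φs : fiberOver f s ⟶ fiberOver f s, Φs ≫ fiberι f s = fiberι f s ≫ Φ ∧ (e s).hom ≫ Φs = (φ s).hom.hom.hom ≫ (e s).hom)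
    (k : ℕ) (χ : ℕ → ℕ → ℂ) (U₁ : complexBetti 𝒳 k) {t : ComplexPoints S}
    (hUt : complexBetti.map (e t).hom k (complexBetti.map (fiberι f t) k U₁) ∈ pullbackEigenclasses (A t) (φ t) k χ)
    (s : ComplexPoints S) :
    complexBetti.map (e s).hom k (complexBetti.map (fiberι f s) k U₁) ∈ pullbackEigenclasses (A s) (φ s) k χ := by
  choose Φf hΦf he using hK
  haveI : IsProper S.hom := IsSmoothProjective.isProper_holds hf.isSmoothProjective_base
  haveI : CompactSpace S.left := QuasiCompact.compactSpace_of_compactSpace S.hom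
  haveI := hf.isSmoothProjective_base.smoothOfRelativeDimension
  haveI : IsProper f.left := hf.isSmoothProjectiveFamily.isProper
  haveI := hf.isSmoothProjectiveFamily.smoothOfRelativeDimension
  haveI := connectedSpace_complexPoints hf.isSmoothProjective_base
  haveI := pathConnectedSpace_complexPoints_of_smoothOfRelativeDimension S 1
  have hcont : Continuous fun x : ComplexPoints S => (⟨x, Set.mem_univ x⟩ : (Set.univ : Set (ComplexPoints S))) :=
    continuous_id.subtype_mk _
  exact mem_pullbackEigenclasses_of_transport f (isCohomologicallyLocallyTrivialOn_univ f d 1) Φ hΦ Φf hΦf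
    (t := ⟨t, Set.mem_univ t⟩) (s := ⟨s, Set.mem_univ s⟩) ⟦(PathConnectedSpace.somePath t s).map hcont⟧
    (e t) (e s) (he t) (he s) k χ U₁ hUt

end EigenTransport

/-! ## §3 THE ENGINE: β in the middle degree from an auxiliary carrier of the invariants -/

section Engine

variable {𝒳 S : SchemeOver ℂ} {d : ℕ} {f : 𝒳 ⟶ S} (hf : IsCompactAbelianPencil f d)

/-- `𝐆[hf, s, k]` — `j_{s*}` (display notation). [cite: FultonYoungTableaux1997, Appendix B §B.1 (5)] -/
local notation3 (prettyPrint := false) "𝐆[" hf ", " s ", " k "]" =>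
  complexGysin complexOrientationFamily (IsCompactAbelianPencil.isSmoothProjective_fiberOver hf s)
    (IsCompactAbelianPencil.isSmoothProjective_total hf) (fiberι f s) (deg_fiberGysin_aux k d)

/-- `𝐣[s, k]` — `j_s^*` (display notation). [cite: VoisinHodgeI2002, §7.3.2] -/
local notation3 (prettyPrint := false) "𝐣[" s ", " k "]" => (complexBetti.map (fiberι f s) k).hom

/-- `⟪x, y⟫[hf, t, h]` — the Poincaré pairing of the FIBRE (display notation). [cite: HatcherAT2002, §3.3 p. 249] -/
local notation3 (prettyPrint := false) "⟪" x ", " y "⟫[" hf ", " t ", " h "]" =>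
  cupPairing (complexOrientationFamily (IsCompactAbelianPencil.isSmoothProjective_fiberOver hf t)) h x y

/-- `⟪x, y⟫𝒳[hf, h]` — the Poincaré pairing of the TOTAL SPACE (display notation). [cite: HatcherAT2002, §3.3 p. 249] -/
local notation3 (prettyPrint := false) "⟪" x ", " y "⟫𝒳[" hf ", " h "]" =>
  cupPairing (complexOrientationFamily (IsCompactAbelianPencil.isSmoothProjective_total hf)) h x y

/-- **`Dᵗ ∘ j_{t*}` IS INJECTIVE ON THE INVARIANTS WHEN `j_t^* ∘ D` MAPS ONTO THEM.** For a compact pencil of abelian `d`-folds, a smooth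
projective `B` of dimension `m`, linear maps `D : H^m(B) → H^d(𝒳)`, `Dt : H^{d+2}(𝒳) → H^m(B)` ADJOINT for the Poincaré pairings
(`⟨D α, W'⟩_𝒳 = σ ⟨Dt W', α⟩_B`) and such that `j_t^* ∘ D` maps onto `j_t^* H^d(𝒳)`: `Dt (j_{t*} j_t^* W') = 0 ⟹ j_t^* W' = 0`. Proof: pair
`j_t^* W'` against `H^d(X_t) = Im j_t^* ⊕ ker j_{t*}` (Deligne); `⟨j_t^* W', ker j_{t*}⟩ = 0` and `⟨j_t^* W', j_t^* D α⟩ = ⟨j_{t*} j_t^* W', D α⟩ =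
± σ ⟨Dt j_{t*} j_t^* W', α⟩ = 0`. [cite: DeligneHodgeII1971, Thm. 4.1.1 (iii)] [cite: HatcherAT2002, §3.3 Prop. 3.38] -/
theorem map_fiberι_eq_zero_of_transpose_fiberGysin_eq_zero (t : ComplexPoints S) {m : ℕ} {B : SchemeOver ℂ}
    (hB : IsSmoothProjective m B) (D : complexBetti B m →ₗ[ℂ] complexBetti 𝒳 d)
    (Dt : complexBetti 𝒳 (d + 2) →ₗ[ℂ] complexBetti B m) {σ : ℂ}
    (hDt : ∀ (α : complexBetti B m) (W' : complexBetti 𝒳 (d + 2)),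
      ⟪D α, W'⟫𝒳[hf, (by omega : d + (d + 2) = 2 * (d + 1))] =
        σ * cupPairing (complexOrientationFamily hB) (by omega : m + m = 2 * m) (Dt W') α)
    (honto : ∀ W : complexBetti 𝒳 d, ∃ α : complexBetti B m, 𝐣[t, d] (D α) = 𝐣[t, d] W)
    (W' : complexBetti 𝒳 d) (h0 : Dt (𝐆[hf, t, d] (𝐣[t, d] W')) = 0) : 𝐣[t, d] W' = 0 := by
  have hXt := hf.isSmoothProjective_fiberOver t
  refine eq_zero_of_forall_cupPairing_eq_zero complexOrientationFamily hXt (k := d) (l := d) (by omega) fun y ↦ ?_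
  obtain ⟨y₁, z, hy₁, hz, rfl⟩ :=
    (Submodule.codisjoint_iff_exists_add_eq.1 (isCompl_range_ker_fiberGysin hf t d).codisjoint) y
  obtain ⟨V, rfl⟩ := hy₁
  have hz' : 𝐆[hf, t, d] z = 0 := LinearMap.mem_ker.1 hz
  rw [map_add, cupPairing_map_fiberι_eq_zero_of_fiberGysin_eq_zero hf t (by omega) W' hz', add_zero]
  obtain ⟨α, hα⟩ := honto V
  rw [← hα, ← cupPairing_fiberGysin_eq hf t (by omega : d + 2 + d = 2 * (d + 1)) (by omega),
    cupPairing_total_comm hf (by omega) (by omega : d + (d + 2) = 2 * (d + 1)), hDt α, h0, map_zero,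
    LinearMap.zero_apply, mul_zero, mul_zero]

/-- **THE ENGINE — β IN THE MIDDLE DEGREE FROM AN AUXILIARY CARRIER OF THE INVARIANTS.** Let `f : 𝒳 ⟶ S` be a compact pencil of abelian
`d`-folds, `t ∈ S(ℂ)`, `B` smooth projective of dimension `m`, and `D : H^m(B(ℂ); ℂ) → H^d(𝒳(ℂ); ℂ)` an ALGEBRAIC correspondence (a class on
`𝒳 × B`) such that (i) `j_t^* ∘ D` maps `H^m(B)` ONTO the invariants `j_t^* H^d(𝒳)` and (ii) `dim H^m(B) ≤ dim j_t^* H^d(𝒳)`. Then β holds at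
`t` in degree `d`: there is an ALGEBRAIC `T : H^{d+2}(𝒳) → H^d(𝒳)` with `j_t^* T j_{t*} j_t^* = j_t^*`. Witness: `D ∘ Dᵗ` (part XLVI-a's
Poincaré transpose; algebraic by composition), made exact by part XLI-a's Cayley–Hamilton transfer; its fibre trace is injective on the
invariants: `Dᵗ j_{t*}` is injective there (previous lemma), so by (ii) it maps the invariants ONTO `H^m(B)`; if `j_t^* D u = 0` for
`u = Dᵗ j_{t*} x` then `⟨Dᵗ j_{t*} x', u⟩_B = ± ⟨j_t^* x'…⟩ = ± ⟨x', j_t^* D u⟩ = 0` for all invariant `x'`, so `u ⊥ H^m(B)`, `u = 0`, `x = 0`.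
[cite: Kleiman1968AlgebraicCycles, §1.3 and Appendix to §2, Thm. 2A11] [cite: Fulton1998, §16.1] [cite: DeligneHodgeII1971, Thm. 4.1.1 (iii)]
[cite: Andre1996Motifs, §5.1 (p. 25)] -/
theorem exists_betaInverse_middle_of_auxiliary (t : ComplexPoints S) {m : ℕ} {B : SchemeOver ℂ} (hB : IsSmoothProjective m B)
    {D : complexBetti B m →ₗ[ℂ] complexBetti 𝒳 d} (algD : IsAlgebraicCorrespondence (d + 1) m 𝒳 B D)
    (honto : ∀ W : complexBetti 𝒳 d, ∃ α : complexBetti B m, 𝐣[t, d] (D α) = 𝐣[t, d] W)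
    (hdim : Module.finrank ℂ (complexBetti B m) ≤ Module.finrank ℂ (LinearMap.range 𝐣[t, d])) :
    ∃ T : complexBetti 𝒳 (d + 2) →ₗ[ℂ] complexBetti 𝒳 d, IsAlgebraicCorrespondence (d + 1) (d + 1) 𝒳 𝒳 T ∧
      ∀ W, 𝐣[t, d] (T (𝐆[hf, t, d] (𝐣[t, d] W))) = 𝐣[t, d] W := by
  have h𝒳 := hf.isSmoothProjective_total
  have hXt := hf.isSmoothProjective_fiberOver t
  haveI : Module.Finite ℂ (complexBetti B m) := finite_complexBetti hB m
  haveI : Module.Finite ℂ (complexBetti (fiberOver f t) d) := finite_complexBetti hXt d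
  -- the Poincaré transpose of `D`
  obtain ⟨Dt, algDt, hDt⟩ := IsAlgebraicCorrespondence.exists_transpose h𝒳 hB (a := m) (b := d) (a' := m) (b' := d + 2)
    (by omega) (by omega) algD
  have algM : IsAlgebraicCorrespondence (d + 1) (d + 1) 𝒳 𝒳 (D ∘ₗ Dt) :=
    IsAlgebraicCorrespondence.comp h𝒳 hB h𝒳 algDt algD (by omega)
  -- Step A: `Dt j_{t*}` is injective on the invariants
  have stepA : ∀ W' : complexBetti 𝒳 d, Dt (𝐆[hf, t, d] (𝐣[t, d] W')) = 0 → 𝐣[t, d] W' = 0 :=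
    map_fiberι_eq_zero_of_transpose_fiberGysin_eq_zero hf t hB D Dt hDt honto
  -- Step B: hence `Dt j_{t*}` maps the invariants ONTO `H^m(B)` (dimension count (ii))
  set LI : LinearMap.range 𝐣[t, d] →ₗ[ℂ] complexBetti B m := (Dt ∘ₗ 𝐆[hf, t, d]).domRestrict (LinearMap.range 𝐣[t, d]) with hLI
  have hker : LinearMap.ker LI = ⊥ := by
    rw [LinearMap.ker_eq_bot']
    rintro ⟨x, W', rfl⟩ h
    exact Subtype.ext (stepA W' (by simpa only [hLI, LinearMap.domRestrict_apply, LinearMap.comp_apply] using h))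
  have hrange : LinearMap.range LI = ⊤ := by
    apply Submodule.eq_top_of_finrank_eq
    refine le_antisymm (Submodule.finrank_le _) ?_
    have h := LinearMap.finrank_range_add_finrank_ker LI
    rw [hker, finrank_bot, add_zero] at h
    rw [h]
    exact hdim
  have hsurj : ∀ β : complexBetti B m, ∃ W' : complexBetti 𝒳 d, Dt (𝐆[hf, t, d] (𝐣[t, d] W')) = β := by
    intro β
    obtain ⟨⟨x, W', rfl⟩, hx⟩ : β ∈ LinearMap.range LI := by rw [hrange]; exact Submodule.mem_top
    exact ⟨W', by simpa only [hLI, LinearMap.domRestrict_apply, LinearMap.comp_apply] using hx⟩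
  -- the transfer of part XLI-a: non-degeneracy of the fibre trace of `D ∘ Dt`
  refine exists_betaInverse_of_nondegenerate hf t (k := d) (by omega) algM fun W hW ↦ ?_
  -- Step C: `u := Dt j_{t*} j_t^* W` is orthogonal to `H^m(B)`, hence zero
  have hu : Dt (𝐆[hf, t, d] (𝐣[t, d] W)) = 0 := by
    refine eq_zero_of_forall_cupPairing_eq_zero complexOrientationFamily hB (k := m) (l := m) (by omega) fun β ↦ ?_
    obtain ⟨W', rfl⟩ := hsurj β
    -- `⟨u, Dt G j W'⟩_B = ± ⟨Dt G j W', u⟩_B` and `σ ⟨Dt G j W', u⟩_B = ⟨D u, G j W'⟩_𝒳 = ± ⟨j W', j (D u)⟩_{X_t} = 0`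
    have key : cupPairing (complexOrientationFamily hB) (by omega : m + m = 2 * m)
        (Dt (𝐆[hf, t, d] (𝐣[t, d] W'))) (Dt (𝐆[hf, t, d] (𝐣[t, d] W))) = 0 := by
      have h1 := hDt (Dt (𝐆[hf, t, d] (𝐣[t, d] W))) (𝐆[hf, t, d] (𝐣[t, d] W'))
      rw [cupPairing_total_comm hf (by omega) (by omega : d + 2 + d = 2 * (d + 1)),
        cupPairing_fiberGysin_eq hf t (by omega : d + 2 + d = 2 * (d + 1)) (by omega)] at h1
      have h2 : 𝐣[t, d] (D (Dt (𝐆[hf, t, d] (𝐣[t, d] W)))) = 0 := by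
        simpa only [LinearMap.comp_apply] using hW
      rw [h2, map_zero, mul_zero] at h1
      have hσ : ((-1 : ℂ) ^ (m * (d + 2))) ≠ 0 := pow_ne_zero _ (neg_ne_zero.2 one_ne_zero)
      exact (mul_eq_zero.1 h1.symm).resolve_left hσ
    rw [cupPairing_comm_smoothProjective hB (by omega) (by omega : m + m = 2 * m), key, mul_zero]
  -- Step D
  exact stepA W hu

end Engine

end Summit.HodgeConjecture.HodgeConjecture.Ring2.AbelianAll

end
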